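import Summits.QuantumFields.BalabanUV.Gaps.EndTopRunCriterion

/-!
# Gaps / EndContAlongFoliation — the use-site reading of the continuity letter (C) on the END roads: (C), like (U) and (PS), is consumed only
# through its TRACE ON THE γ₀-CLAMPED FORWARD SHOOTING FOLIATION `x ↦ clampPrefix β γ₀ k x` (the foliation restriction `folH`; (D) and
# `FlowStepRuns.endpointExistence_of_partialSums` used as black boxes) — a PORT into the tree, with attribution, of g1-plan-2 GEN 18's lens
# kernel `HOME/g1/skeletons/XreadHordFadingMemory_plan2.lean` (v1.8, sha16 4a2dd778a9e40b0b, §13 `section FoliationCensus`; lens item S-45 ∕ R-37,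
# offered for porting in [G1-PLAN2-G18-S45])
# (cell pub-balaban-gaps, seat g1-p3 gen 7, row CAP+tail ∕ β-currency «split ∕ weakening»; file 2 of 4 of «the binder census of the END roads»)

HONEST FRAMING (cell rule, page 1 of everything): [folklore] real analysis over the tree's typed carriers (`FlowStep.HBeta` ∕ `Y` ∕ `gClamp` ∕
`clampPrefix` ∕ `RGEqH`, `FlowStepRuns.BetaPartialSumsLowerH`, `DagBinding.ForwardGenerated` ∕ `EndpointExistence` ∕ `modelOf`,
`EndRunwiseShooting.Y_eq_of_run`).  AUTHORSHIP: the mathematics and the Lean text of every declaration below are g1-plan-2 GEN 18's (planner seat;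
planners file nothing on the ledger by mandate — «provers may port»); this seat's contribution is the port (namespace, imports, this header) and
the kernel re-check against the tree.  Every β-side hypothesis (trace continuity, trace bounds, (PS) along the foliation, non-crossing) is a BINDER
(a hypothesis SHAPE); for Bałaban's β continuity (indeed smoothness ∕ analyticity) in the coupling is ASSERTED in print ([I] §1 pp. 263–264; no
located proof — GAPS G-adv2-3 ∕ G-adv2-6), so NO word of record moves: the statements are about the hypothesis sets of the tree's END theorems.
`EndpointExistence` appears only as a conclusion of ∕ inside an equivalence with hypotheses named in the signature.  NOTHING of Bałaban's is
asserted; 0∕6 binders; 0 coefficients certified; one finite T⁴; NOT B12 Thm 2, NOT `BetaPertH`, NOT the continuum limit, NOT Clay.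

THE POINT (g1-plan-2 S-45 ∕ R-37, verbatim in substance).  Every END theorem of the tree that takes (C) `BetaContH γ₀ β` (joint continuity of
each `β_k` on the (k+1)-dimensional box) consumes it at ONE kind of place: continuity IN THE TRIAL BARE COUPLING `x` of the γ₀-clamped forward
table `x ↦ Y_k(x)` (`FlowStep.continuousOn_Y`: the IVT of `couplingTrajectory_exists_partialSums` at the W-β ∕ sign sockets; the supremum of
`EndRunwiseShooting.shooting_dichotomy` at the order sockets (D) ∕ (G) ∕ (H)), and that table reads `β_k` only on the ONE-PARAMETER family
`x ↦ clampPrefix β γ₀ k x = (ĝ(Y_0(x)),…,ĝ(Y_k(x)))`, `x ∈ ]0,γ₀]` (unclamped leaves = the in-interval runs of (0.20), `EndRunwiseShooting.Y_eq_of_run`).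
With the FOLIATION RESTRICTION **`folH β γ₀ k v := β_k(clampPrefix β γ₀ k (v 0))`**: trace letters ⟹ box letters for `folH` (`betaContH_folH`,
`betaUpperH_folH`, `perLevelUpper_folH`, `betaPartialSumsLowerH_folH`; converses `folCont_of_betaContH` etc.); SAME γ₀-clamped table (`Y_folH`) and
SAME IN-INTERVAL RUNS AT EVERY LEVEL `γ ≤ γ₀` (`rgEqH_folH_of_rgEqH`, `rgEqH_of_rgEqH_folH`), hence same `hord` (`hord_folH`), same top-run data
(`topRuns_of_runs`), same END binder (END TRANSFER `endpointExistence_of_runs`, `endpointExistence_iff_modelOf`).  CONSEQUENCES: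
**`endpointExistence_iff_topRuns_folCont`** = (D)'s construction-level criterion with (C) and (U) replaced by «the traces are continuous on `]0,γ₀]`
and `≤ β′` there»; the W-β road **`endpointExistence_of_foliationLetters`** ((C), (U), (PS) ALL along the foliation ⟹ END);
**`folCont_iff_continuousOn_Y`** (the trace condition IS continuity of the clamped composites `Y_k`).  The PER-LEVEL-bound forms (combining this
leaf with `Gaps/EndUpperPerLevel`) and the datum ∕ headline transport are in the companion leaf `Gaps/EndFoliationHeadline`.  That trace continuity stays LOAD-BEARING on the order roads (g1-plan-2's N-15
floor staircase is discontinuous along the foliation) is recorded in the companion witness leaf `Gaps/EndContLetterWitness` (file 3).  NOT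
CLAIMED: that continuity along the REALISED runs alone suffices.  BEARING (located remark of the author, NOT an ask): binder B4
`hC : FlowStep.BetaContH γc D.βfun` of the T⁴ headline is needed by the END roads only as continuity in the bare coupling of countably many
ONE-variable functions.
0 sorry; ONE auxiliary function `folH : HBeta → ℝ → HBeta` (no `def … : Prop`, no toy family); imports (D) `Gaps/EndTopRunCriterion` only (which
re-exports (A) `Gaps/EndRunwiseShooting` and `FlowStepRuns`); restates nothing of the tree.

CITATION HEADER (tags CONTEXT ONLY).  [I] = T. Bałaban, Commun. Math. Phys. **109** (1987) [Balaban1987RG1]: Thm 2 p. 259, (0.20) p. 256,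
§1 pp. 263–264 (continuity ∕ analyticity in the coupling asserted).
-/

namespace Summit.QuantumFields.BalabanUV.Gaps.EndContAlongFoliation

open Literature.MathematicalPhysics.QuantumFieldTheory.Balaban1983to89
open Literature.MathematicalPhysics.QuantumFieldTheory.Balaban1983to89.FlowStep
open Literature.MathematicalPhysics.QuantumFieldTheory.Balaban1983to89.FlowStepRuns
open Literature.MathematicalPhysics.QuantumFieldTheory.Balaban1983to89.DagBinding
open Summit.QuantumFields.BalabanUV.Gaps.EndRunwiseShooting
open Summit.QuantumFields.BalabanUV.Gaps.EndTopRunCriterion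
open Topology Finset

noncomputable section

/-! ## §1 The foliation restriction `folH`: trace letters ⟺ box letters, same clamped table, same in-interval runs (g1-plan-2 kernel §13, ported) -/

/-- THE FOLIATION RESTRICTION of a history family at reference level `γ₀`: `β_k` read along the `γ₀`-CLAMPED FORWARD SHOOTING PREFIX from the
history's OWN bare coupling — `(folH β γ₀)_k (g_0,…,g_k) := β_k(ĝ(Y_0(g_0)),…,ĝ(Y_k(g_0)))`; a function of `(k, g_0)` alone (an auxiliary
FUNCTION on the tree's carrier `HBeta`, not a `Prop`; nothing of Bałaban's). [folklore] -/
def folH (β : HBeta) (γ₀ : ℝ) : HBeta := fun k v => β k (clampPrefix β γ₀ k (v 0))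

/-- Unfolding. [folklore] -/
theorem folH_apply (β : HBeta) (γ₀ : ℝ) (k : ℕ) (v : Fin (k + 1) → ℝ) :
    folH β γ₀ k v = β k (clampPrefix β γ₀ k (v 0)) := rfl

/-- (C) ALONG THE FOLIATION ⟹ (C) ON THE BOXES for the restriction: if each one-variable trace `x ↦ β_k(ĝ(Y_0(x)),…,ĝ(Y_k(x)))` is continuous on
`]0,γ₀]`, then `folH β γ₀` is jointly continuous on every box `]0,γ₀]^{k+1}`. [folklore] -/
theorem betaContH_folH {β : HBeta} {γ₀ : ℝ}
    (hfol : ∀ k : ℕ, ContinuousOn (fun x : ℝ => β k (clampPrefix β γ₀ k x)) (Set.Ioc 0 γ₀)) :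
    BetaContH γ₀ (folH β γ₀) := by
  intro k
  have h0 : ContinuousOn (fun v : Fin (k + 1) → ℝ => v 0) (Box γ₀ k) := (continuous_apply 0).continuousOn
  exact (hfol k).comp h0 fun v hv => Set.mem_Ioc.mpr ((mem_box.mp hv) 0)

/-- THE TRACE CONDITION IS CONTINUITY OF THE CLAMPED TABLE: the traces `x ↦ β_k(clampPrefix β γ₀ k x)` are continuous on `]0,γ₀]` for every `k`
iff the clamped composites `x ↦ Y_k(x)` are (`Y_{k+1} = Y_k − β_k ∘ clampPrefix`, `Y_0 = 1∕x²`) — literally the functions the IVT ∕ supremum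
arguments of the END roads act on. [folklore] -/
theorem folCont_iff_continuousOn_Y {β : HBeta} {γ₀ : ℝ} :
    (∀ k : ℕ, ContinuousOn (fun x : ℝ => β k (clampPrefix β γ₀ k x)) (Set.Ioc 0 γ₀)) ↔
      ∀ k : ℕ, ContinuousOn (Y β γ₀ k) (Set.Ioc 0 γ₀) := by
  have hY0 : ContinuousOn (Y β γ₀ 0) (Set.Ioc 0 γ₀) := by
    have e0 : Y β γ₀ 0 = fun g₀ => 1 / g₀ ^ 2 := funext (Y_zero (β := β) (γ := γ₀))
    rw [e0]
    exact continuousOn_const.div (continuous_pow 2).continuousOn fun x hx => pow_ne_zero 2 (ne_of_gt hx.1)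
  have e : ∀ k : ℕ, Y β γ₀ (k + 1) = fun x => Y β γ₀ k x - β k (clampPrefix β γ₀ k x) :=
    fun k => funext (Y_succ' (β := β) (γ := γ₀) k)
  constructor
  · intro hfol k
    induction k with
    | zero => exact hY0
    | succ k ih => rw [e k]; exact ih.sub (hfol k)
  · intro hY k
    have e' : (fun x : ℝ => β k (clampPrefix β γ₀ k x)) = fun x => Y β γ₀ k x - Y β γ₀ (k + 1) x := by
      funext x; rw [Y_succ' (β := β) (γ := γ₀) k x]; ring
    rw [e']
    exact (hY k).sub (hY (k + 1))

/-- (U) ALONG THE FOLIATION ⟹ (U) ON THE BOXES for the restriction. [folklore] -/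
theorem betaUpperH_folH {β : HBeta} {γ₀ β' : ℝ}
    (hhiFol : ∀ (k : ℕ) (x : ℝ), 0 < x → x ≤ γ₀ → β k (clampPrefix β γ₀ k x) ≤ β') :
    BetaUpperH β' γ₀ (folH β γ₀) :=
  fun k v hv => hhiFol k (v 0) ((mem_box.mp hv) 0).1 ((mem_box.mp hv) 0).2

/-- PER-LEVEL (U) ALONG THE FOLIATION ⟹ per-level (U) on the boxes for the restriction (`Gaps/EndUpperPerLevel`'s hypothesis shape). [folklore] -/
theorem perLevelUpper_folH {β : HBeta} {γ₀ : ℝ}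
    (hlocFol : ∀ k : ℕ, ∃ B : ℝ, ∀ x : ℝ, 0 < x → x ≤ γ₀ → β k (clampPrefix β γ₀ k x) ≤ B) :
    ∀ k : ℕ, ∃ B : ℝ, ∀ v : Fin (k + 1) → ℝ, v ∈ Box γ₀ k → folH β γ₀ k v ≤ B := by
  intro k
  obtain ⟨B, hB⟩ := hlocFol k
  exact ⟨B, fun v hv => hB (v 0) ((mem_box.mp hv) 0).1 ((mem_box.mp hv) 0).2⟩

/-- (PS) ALONG THE FOLIATION ⟹ (PS) ON ALL BOX HISTORIES for the restriction. [folklore] -/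
theorem betaPartialSumsLowerH_folH {β : HBeta} {γ₀ M : ℝ}
    (hpsFol : ∀ x : ℝ, 0 < x → x ≤ γ₀ → ∀ k n : ℕ, k ≤ n → -M ≤ ∑ j ∈ Finset.Ico k n, β j (clampPrefix β γ₀ j x)) :
    BetaPartialSumsLowerH M γ₀ (folH β γ₀) := by
  intro g hg k n hkn
  show -M ≤ ∑ j ∈ Finset.Ico k n, β j (clampPrefix β γ₀ j (g 0))
  exact hpsFol (g 0) (hg 0).1 (hg 0).2 k n hkn

/-- BOX LETTERS ⟹ FOLIATION LETTERS (so every criterion below implies its box version): (C) on the boxes gives (C) along the foliation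
(`FlowStep.continuousOn_Y` composed with the clamp) … [folklore] -/
theorem folCont_of_betaContH {β : HBeta} {γ₀ : ℝ} (hγ₀ : 0 < γ₀) (hcont : BetaContH γ₀ β) :
    ∀ k : ℕ, ContinuousOn (fun x : ℝ => β k (clampPrefix β γ₀ k x)) (Set.Ioc 0 γ₀) := by
  intro k
  have hpre : ContinuousOn (fun x : ℝ => clampPrefix β γ₀ k x) (Set.Ioi 0) := by
    rw [continuousOn_pi]
    intro j
    exact (continuous_gClamp hγ₀).comp_continuousOn (continuousOn_Y hγ₀ hcont j)
  exact ((hcont k).comp hpre fun x _ => clampPrefix_mem_box hγ₀ k x).mono fun x hx => hx.1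

/-- … (U) on the boxes gives (U) along the foliation … [folklore] -/
theorem folUpper_of_betaUpperH {β : HBeta} {γ₀ β' : ℝ} (hγ₀ : 0 < γ₀) (hhi : BetaUpperH β' γ₀ β) :
    ∀ (k : ℕ) (x : ℝ), 0 < x → x ≤ γ₀ → β k (clampPrefix β γ₀ k x) ≤ β' :=
  fun k x _ _ => hhi k _ (clampPrefix_mem_box hγ₀ k x)

/-- … per-level (U) on the boxes gives per-level (U) along the foliation … [folklore] -/
theorem folLocUpper_of_perLevelUpper {β : HBeta} {γ₀ : ℝ} (hγ₀ : 0 < γ₀)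
    (hloc : ∀ k : ℕ, ∃ B : ℝ, ∀ v : Fin (k + 1) → ℝ, v ∈ Box γ₀ k → β k v ≤ B) :
    ∀ k : ℕ, ∃ B : ℝ, ∀ x : ℝ, 0 < x → x ≤ γ₀ → β k (clampPrefix β γ₀ k x) ≤ B := by
  intro k
  obtain ⟨B, hB⟩ := hloc k
  exact ⟨B, fun x _ _ => hB _ (clampPrefix_mem_box hγ₀ k x)⟩

/-- … and (PS) on all box histories gives (PS) along the foliation. [folklore] -/
theorem folPS_of_betaPartialSumsLowerH {β : HBeta} {γ₀ M : ℝ} (hγ₀ : 0 < γ₀) (hps : BetaPartialSumsLowerH M γ₀ β) :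
    ∀ x : ℝ, 0 < x → x ≤ γ₀ → ∀ k n : ℕ, k ≤ n → -M ≤ ∑ j ∈ Finset.Ico k n, β j (clampPrefix β γ₀ j x) := by
  intro x _ _ k n hkn
  have h := hps (fun i => gClamp γ₀ (Y β γ₀ i x)) (fun i => ⟨gClamp_pos hγ₀ _, gClamp_le hγ₀ _⟩) k n hkn
  simpa only [clampPrefix_eq_prefixOf] using h

/-- THE RESTRICTION HAS THE SAME γ₀-CLAMPED SHOOTING TABLE on `]0,γ₀]`: `Y_k^{folH}(x) = Y_k^{β}(x)` — the clamped prefix from `x` starts AT `x`,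
so `folH` fed its own clamped prefix returns `β` fed β's. [folklore] -/
theorem Y_folH {β : HBeta} {γ₀ : ℝ} (k : ℕ) {x : ℝ} (hx : 0 < x) (hxγ : x ≤ γ₀) :
    Y (folH β γ₀) γ₀ k x = Y β γ₀ k x := by
  induction k with
  | zero => rw [Y_zero, Y_zero]
  | succ k ih =>
    have h0 : clampPrefix (folH β γ₀) γ₀ k x 0 = x := by
      show gClamp γ₀ (Y (folH β γ₀) γ₀ ((0 : Fin (k + 1)) : ℕ) x) = x
      rw [Fin.val_zero, Y_zero, gClamp_inv_sq hx hxγ]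
    rw [Y_succ' (β := folH β γ₀) (γ := γ₀) k x, Y_succ' (β := β) (γ := γ₀) k x, ih, folH_apply, h0]

/-- ALONG AN IN-INTERVAL RUN OF (0.20) AT ANY LEVEL `γ ≤ γ₀` the restriction agrees with `β` (the run is a survivor of the γ₀-clamped shooting
from its own `g_0`, `EndRunwiseShooting.Y_eq_of_run`) … [folklore] -/
theorem folH_prefixOf_of_run {β : HBeta} {γ₀ γ : ℝ} (hγle : γ ≤ γ₀) {n : ℕ} {gs : ℕ → ℝ}
    (hrg : RGEqH n β gs) (hI : Step.InInterval γ n gs) :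
    ∀ k, k ≤ n → folH β γ₀ k (prefixOf gs k) = β k (prefixOf gs k) := by
  intro k hk
  have hI₀ : Step.InInterval γ₀ n gs := fun j hj => ⟨(hI j hj).1, (hI j hj).2.trans hγle⟩
  rw [folH_apply, prefixOf_apply, Fin.val_zero, (Y_eq_of_run hrg hI₀ k hk).2]

/-- … so every in-interval `β`-run is a `folH β γ₀`-run … [folklore] -/
theorem rgEqH_folH_of_rgEqH {β : HBeta} {γ₀ γ : ℝ} (hγle : γ ≤ γ₀) {n : ℕ} {gs : ℕ → ℝ}
    (hrg : RGEqH n β gs) (hI : Step.InInterval γ n gs) : RGEqH n (folH β γ₀) gs := by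
  intro k hk
  rw [folH_prefixOf_of_run hγle hrg hI k hk.le]
  exact hrg k hk

/-- … and conversely every in-interval `folH β γ₀`-run is a `β`-run (via `Y_folH`: the folH-shooting that reproduces the run IS the β-shooting).
THE TWO FAMILIES HAVE THE SAME IN-INTERVAL RUNS AT EVERY LEVEL `γ ≤ γ₀`. [folklore] -/
theorem rgEqH_of_rgEqH_folH {β : HBeta} {γ₀ γ : ℝ} (hγle : γ ≤ γ₀) {n : ℕ} {gs : ℕ → ℝ}
    (hrg : RGEqH n (folH β γ₀) gs) (hI : Step.InInterval γ n gs) : RGEqH n β gs := by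
  have hI₀ : Step.InInterval γ₀ n gs := fun j hj => ⟨(hI j hj).1, (hI j hj).2.trans hγle⟩
  have hx : 0 < gs 0 := (hI₀ 0 (Nat.zero_le _)).1
  have hxγ : gs 0 ≤ γ₀ := (hI₀ 0 (Nat.zero_le _)).2
  have hpre : ∀ k, k ≤ n → clampPrefix β γ₀ k (gs 0) = prefixOf gs k := by
    intro k hk
    have h := (Y_eq_of_run hrg hI₀ k hk).2
    funext j
    have hj := congrFun h j
    show gClamp γ₀ (Y β γ₀ j (gs 0)) = prefixOf gs k j
    rw [← Y_folH (β := β) (γ₀ := γ₀) j hx hxγ]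
    exact hj
  intro k hk
  have e : folH β γ₀ k (prefixOf gs k) = β k (prefixOf gs k) := by
    rw [folH_apply, prefixOf_apply, Fin.val_zero, hpre k hk.le]
  rw [← e]
  exact hrg k hk

/-- Non-crossing transfers to the restriction (same runs). [folklore] -/
theorem hord_folH {β : HBeta} {γ₀ : ℝ}
    (hord : ∀ γ : ℝ, 0 < γ → γ ≤ γ₀ → ∀ (n : ℕ) (gs gs' : ℕ → ℝ), RGEqH n β gs → RGEqH n β gs' →
      Step.InInterval γ n gs → Step.InInterval γ n gs' → gs 0 < gs' 0 → ∀ k, k ≤ n → gs k < gs' k) :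
    ∀ γ : ℝ, 0 < γ → γ ≤ γ₀ → ∀ (n : ℕ) (gs gs' : ℕ → ℝ), RGEqH n (folH β γ₀) gs → RGEqH n (folH β γ₀) gs' →
      Step.InInterval γ n gs → Step.InInterval γ n gs' → gs 0 < gs' 0 → ∀ k, k ≤ n → gs k < gs' k :=
  fun γ hγ hγle n gs gs' hrg hrg' hI hI' h0 =>
    hord γ hγ hγle n gs gs' (rgEqH_of_rgEqH_folH hγle hrg hI) (rgEqH_of_rgEqH_folH hγle hrg' hI') hI hI' h0

/-! ## §2 END transfer along shared runs; (D)'s criterion and the W-β road with the letters read ALONG THE FOLIATION (kernel §13, ported) -/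

/-- END TRANSFER BETWEEN CONSTRUCTIONS WHOSE GENERATING FAMILIES SHARE THEIR IN-INTERVAL RUNS (levels `≤ γ₀`): if `C` is forward-generated by
`β`, halts outside and curries `β` (so its in-interval runs solve (0.20) with `β`, `FlowStepRuns.rgEqH_of_inInterval`), `C′` is forward-generated
by `β′`, and every in-interval `β`-run is a `β′`-run, then `EndpointExistence C → EndpointExistence C′` (forward uniqueness,
`FlowStepRuns.flow_eq_of_rgEqH`; the level threshold `γ₂` is shrunk below `γ₀`). [folklore] -/
theorem endpointExistence_of_runs {C C' : B12.Construction} {β β' : HBeta} {γ₀ : ℝ} (hγ₀ : 0 < γ₀)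
    (hgen : ForwardGenerated C β) (hhalt : HaltsOutside C β) (hcur : CurriesHBeta C β) (hgen' : ForwardGenerated C' β')
    (hsame : ∀ γ : ℝ, 0 < γ → γ ≤ γ₀ → ∀ (n : ℕ) (gs : ℕ → ℝ), Step.InInterval γ n gs → RGEqH n β gs → RGEqH n β' gs)
    (hE : EndpointExistence C) : EndpointExistence C' := by
  intro m
  obtain ⟨γ₂, hγ₂, H⟩ := hE m
  refine ⟨min γ₂ γ₀, lt_min hγ₂ hγ₀, fun γ hγ hγle => ?_⟩
  obtain ⟨gstar, hgstar, Hg⟩ := H γ hγ (hγle.trans (min_le_left _ _))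
  refine ⟨gstar, hgstar, fun g hg hgle K => ?_⟩
  obtain ⟨g0, hIK, hK⟩ := Hg g hg hgle K
  have hrg : RGEqH K β (C ⟨K, m, g0⟩).flow.g := rgEqH_of_inInterval hgen hhalt hcur ⟨K, m, g0⟩ hIK
  have hrg' : RGEqH K β' (C ⟨K, m, g0⟩).flow.g := hsame γ hγ (hγle.trans (min_le_right _ _)) K _ hIK hrg
  have heq : ∀ k, k ≤ K → (C' ⟨K, m, g0⟩).flow.g k = (C ⟨K, m, g0⟩).flow.g k :=
    flow_eq_of_rgEqH (C' ⟨K, m, g0⟩).flow β' K (fun k hk => hgen'.2 ⟨K, m, g0⟩ k hk)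
      ((hgen'.1 ⟨K, m, g0⟩).trans (hgen.1 ⟨K, m, g0⟩).symm) hrg' (fun k hk => (hIK k hk).1)
  refine ⟨g0, fun k hk => ?_, ?_⟩
  · rw [heq k hk]; exact hIK k hk
  · rw [heq K le_rfl]; exact hK

/-- In particular the END binder of a forward-generated, halting, currying construction IS that of the canonical construction `modelOf β` of its
generating family (lifts every `modelOf` statement of this leaf and of `Gaps/EndUpperPerLevel` ∕ the witness leaves to construction level). [folklore] -/
theorem endpointExistence_iff_modelOf {C : B12.Construction} {β : HBeta} (hgen : ForwardGenerated C β) (hhalt : HaltsOutside C β)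
    (hcur : CurriesHBeta C β) : EndpointExistence C ↔ EndpointExistence (modelOf β) :=
  ⟨endpointExistence_of_runs zero_lt_one hgen hhalt hcur (modelOf_forwardGenerated β) (fun _ _ _ _ _ _ h => h),
    endpointExistence_of_runs zero_lt_one (modelOf_forwardGenerated β) (modelOf_haltsOutside β) (modelOf_curries β) hgen
      (fun _ _ _ _ _ _ h => h)⟩

/-- TOP-RUN TRANSFER: if every in-interval `β′`-run (levels `≤ γ₀`) is a `β`-run, the top-run condition for `β` gives it for `β′`. [folklore] -/
theorem topRuns_of_runs {β β' : HBeta} {γ₀ : ℝ} (hγ₀ : 0 < γ₀)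
    (hsame : ∀ γ : ℝ, 0 < γ → γ ≤ γ₀ → ∀ (n : ℕ) (gs : ℕ → ℝ), Step.InInterval γ n gs → RGEqH n β' gs → RGEqH n β gs)
    (htop : ∃ γ₂ : ℝ, 0 < γ₂ ∧ ∀ γ : ℝ, 0 < γ → γ ≤ γ₂ → ∃ gstar : ℝ, 0 < gstar ∧
      ∀ (n : ℕ) (gs : ℕ → ℝ), RGEqH n β gs → Step.InInterval γ n gs → ∀ k, k ≤ n → gs k = γ → gstar ≤ gs n) :
    ∃ γ₂ : ℝ, 0 < γ₂ ∧ ∀ γ : ℝ, 0 < γ → γ ≤ γ₂ → ∃ gstar : ℝ, 0 < gstar ∧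
      ∀ (n : ℕ) (gs : ℕ → ℝ), RGEqH n β' gs → Step.InInterval γ n gs → ∀ k, k ≤ n → gs k = γ → gstar ≤ gs n := by
  obtain ⟨γ₂, hγ₂, H⟩ := htop
  refine ⟨min γ₂ γ₀, lt_min hγ₂ hγ₀, fun γ hγ hγle => ?_⟩
  obtain ⟨gstar, hgstar, h⟩ := H γ hγ (hγle.trans (min_le_left _ _))
  exact ⟨gstar, hgstar, fun n gs hrg hI k hk hgk =>
    h n gs (hsame γ hγ (hγle.trans (min_le_right _ _)) n gs hI hrg) hI k hk hgk⟩

/-- **(D)'s END CRITERION WITH (C) AND (U) READ ALONG THE TOP-LEVEL CLAMPED FOLIATION** (construction level).  For a construction generated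
forward by (0.20) with `β`, halting outside and currying `β`: if the ONE-VARIABLE traces `x ↦ β_k(ĝ(Y_0(x)),…,ĝ(Y_k(x)))` (β along the
γ₀-clamped forward shooting prefix from the trial bare coupling `x`) are CONTINUOUS on `]0,γ₀]` and BOUNDED ABOVE by `β′ ≥ 0` there, and
in-interval runs do not cross at levels `≤ γ₀`, then `EndpointExistence C ⟺ the top-run condition` — (D)
`EndTopRunCriterion.endpointExistence_iff_topRuns` with (C) `BetaContH γ₀ β` and (U) `BetaUpperH β′ γ₀ β` (statements on the (k+1)-dimensional
boxes) replaced by their traces on a ONE-PARAMETER family of histories.  Proof: (D) for `modelOf (folH β γ₀)` as a black box + run equivalence +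
END transfer. [cite: Balaban1987RG1, Thm 2 p.259 and (0.20) p.256] -/
theorem endpointExistence_iff_topRuns_folCont {C : B12.Construction} {β : HBeta} (hgen : ForwardGenerated C β)
    (hhalt : HaltsOutside C β) (hcur : CurriesHBeta C β) {γ₀ β' : ℝ} (hγ₀ : 0 < γ₀) (hβ' : 0 ≤ β')
    (hfol : ∀ k : ℕ, ContinuousOn (fun x : ℝ => β k (clampPrefix β γ₀ k x)) (Set.Ioc 0 γ₀))
    (hhiFol : ∀ (k : ℕ) (x : ℝ), 0 < x → x ≤ γ₀ → β k (clampPrefix β γ₀ k x) ≤ β')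
    (hord : ∀ γ : ℝ, 0 < γ → γ ≤ γ₀ → ∀ (n : ℕ) (gs gs' : ℕ → ℝ), RGEqH n β gs → RGEqH n β gs' →
      Step.InInterval γ n gs → Step.InInterval γ n gs' → gs 0 < gs' 0 → ∀ k, k ≤ n → gs k < gs' k) :
    EndpointExistence C ↔
      ∃ γ₂ : ℝ, 0 < γ₂ ∧ ∀ γ : ℝ, 0 < γ → γ ≤ γ₂ → ∃ gstar : ℝ, 0 < gstar ∧
        ∀ (n : ℕ) (gs : ℕ → ℝ), RGEqH n β gs → Step.InInterval γ n gs → ∀ k, k ≤ n → gs k = γ → gstar ≤ gs n := by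
  have hD := endpointExistence_modelOf_iff_topRuns hγ₀ hβ' (betaContH_folH hfol) (betaUpperH_folH hhiFol) (hord_folH hord)
  have h1 : ∀ γ : ℝ, 0 < γ → γ ≤ γ₀ → ∀ (n : ℕ) (gs : ℕ → ℝ), Step.InInterval γ n gs → RGEqH n β gs → RGEqH n (folH β γ₀) gs :=
    fun _ _ hγle _ _ hI hrg => rgEqH_folH_of_rgEqH hγle hrg hI
  have h2 : ∀ γ : ℝ, 0 < γ → γ ≤ γ₀ → ∀ (n : ℕ) (gs : ℕ → ℝ), Step.InInterval γ n gs → RGEqH n (folH β γ₀) gs → RGEqH n β gs :=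
    fun _ _ hγle _ _ hI hrg => rgEqH_of_rgEqH_folH hγle hrg hI
  constructor
  · intro hE
    exact topRuns_of_runs hγ₀ h1 (hD.1 (endpointExistence_of_runs hγ₀ hgen hhalt hcur (modelOf_forwardGenerated _) h1 hE))
  · intro htop
    exact endpointExistence_of_runs hγ₀ (modelOf_forwardGenerated _) (modelOf_haltsOutside _) (modelOf_curries _) hgen h2
      (hD.2 (topRuns_of_runs hγ₀ h2 htop))

/-- The same for the canonical construction `modelOf β` — (D)'s `endpointExistence_modelOf_iff_topRuns` with (C) and (U) along the foliation. [cite: Balaban1987RG1, Thm 2 p.259] -/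
theorem endpointExistence_modelOf_iff_topRuns_folCont {β : HBeta} {γ₀ β' : ℝ} (hγ₀ : 0 < γ₀) (hβ' : 0 ≤ β')
    (hfol : ∀ k : ℕ, ContinuousOn (fun x : ℝ => β k (clampPrefix β γ₀ k x)) (Set.Ioc 0 γ₀))
    (hhiFol : ∀ (k : ℕ) (x : ℝ), 0 < x → x ≤ γ₀ → β k (clampPrefix β γ₀ k x) ≤ β')
    (hord : ∀ γ : ℝ, 0 < γ → γ ≤ γ₀ → ∀ (n : ℕ) (gs gs' : ℕ → ℝ), RGEqH n β gs → RGEqH n β gs' →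
      Step.InInterval γ n gs → Step.InInterval γ n gs' → gs 0 < gs' 0 → ∀ k, k ≤ n → gs k < gs' k) :
    EndpointExistence (modelOf β) ↔
      ∃ γ₂ : ℝ, 0 < γ₂ ∧ ∀ γ : ℝ, 0 < γ → γ ≤ γ₂ → ∃ gstar : ℝ, 0 < gstar ∧
        ∀ (n : ℕ) (gs : ℕ → ℝ), RGEqH n β gs → Step.InInterval γ n gs → ∀ k, k ≤ n → gs k = γ → gstar ≤ gs n :=
  endpointExistence_iff_topRuns_folCont (modelOf_forwardGenerated β) (modelOf_haltsOutside β) (modelOf_curries β) hγ₀ hβ' hfol hhiFol hord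

/-- **THE W-β ROAD ALONG THE FOLIATION** (construction level; `ForwardGenerated` only): (C), (U) and (PS) ALL read along the γ₀-clamped forward
shooting prefixes ⟹ the END binder — `FlowStepRuns.endpointExistence_of_partialSums` (:593) and `EndRunwiseCone.endpointExistence_of_shootingPS`
(which already reads (PS) along the shooting trajectories but keeps (C), (U) on the boxes) with every letter on the one-parameter family. [cite: Balaban1987RG1, Thm 2 p.259] -/
theorem endpointExistence_of_foliationLetters {C : B12.Construction} {β : HBeta} (hgen : ForwardGenerated C β)
    {γ₀ M β' : ℝ} (hγ₀ : 0 < γ₀) (hM : 0 ≤ M) (hβ' : 0 ≤ β')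
    (hfol : ∀ k : ℕ, ContinuousOn (fun x : ℝ => β k (clampPrefix β γ₀ k x)) (Set.Ioc 0 γ₀))
    (hhiFol : ∀ (k : ℕ) (x : ℝ), 0 < x → x ≤ γ₀ → β k (clampPrefix β γ₀ k x) ≤ β')
    (hpsFol : ∀ x : ℝ, 0 < x → x ≤ γ₀ → ∀ k n : ℕ, k ≤ n → -M ≤ ∑ j ∈ Finset.Ico k n, β j (clampPrefix β γ₀ j x)) :
    EndpointExistence C :=
  endpointExistence_of_runs hγ₀ (modelOf_forwardGenerated _) (modelOf_haltsOutside _) (modelOf_curries _) hgen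
    (fun _ _ hγle _ _ hI hrg => rgEqH_of_rgEqH_folH hγle hrg hI)
    (endpointExistence_of_partialSums (modelOf_forwardGenerated (folH β γ₀)) hγ₀ hM hβ' (betaContH_folH hfol)
      (betaPartialSumsLowerH_folH hpsFol) (betaUpperH_folH hhiFol))

end

end Summit.QuantumFields.BalabanUV.Gaps.EndContAlongFoliation
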